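import Mathlib
import Summits.Ventures.PercRepro2.Defs
import Summits.Ventures.PercRepro2.Graph
import Summits.Ventures.PercRepro2.HullDefs
import Summits.Ventures.PercRepro2.LocRows
import Summits.Ventures.PercRepro2.SwRow

/-!
# Row 2′SW-ALL: the rigid form of row (SW) (blind cell PercRepro2, night-4 g5, 2026-08-24;
proofs/NIGHT4-BRIDGE.md §3)

Row (SW) asks for a permutation `Φ` of `Q = {h ∉ H_l, o ∈ R_side(l)}` with `C_R(h)(ζ) ⊆ C_B(h)(Φ ζ)`.
Its RIGID form `SwAll` asks that EVERY RED EDGE INSIDE `C_R(h)(ζ)` be blue in `Φ ζ`: since `C_R(h)`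
is connected by its red edges, this implies row (SW) (`sw_of_swAll`).  The rigid form is the
statement with the fibre-preserving series / parallel reductions (paper, NIGHT4-BRIDGE.md §4) and
it composes across the cut `{l, h}` and along paths exactly like (SW) (next files).
-/

namespace Summit.Ventures.PercRepro2

namespace LocRows

open Hull

variable {V : Type*} {E : Type*} [Fintype E] [DecidableEq E]

open scoped Classical

variable (ends : E → Sym2 V)

/-- **Row 2′SW-ALL** (the rigid form of (SW)): an injection of `Q = {h ∉ H_l, o ∈ R_side(l)}` into
itself under which every red edge inside the red cluster of `h` of the source is blue in the image. -/
def SwAll (l h o : V) : Prop :=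
  ∃ f : {ζ // ζ ∈ tgtU ends l h {S : Set V | o ∈ S}} → Config E, Function.Injective f ∧
    ∀ x, f x ∈ tgtU ends l h {S : Set V | o ∈ S} ∧
      ∀ e, e ∈ within ends (cluster ends x.1 h) → x.1 e = true → f x e = false

omit [Fintype E] [DecidableEq E] in
/-- **The rigid form gives (SW)**: if every red edge inside `C_R(h)(ζ)` is blue in `η`, then
`C_R(h)(ζ) ⊆ C_B(h)(η)`. -/
theorem cluster_subset_of_red_flipped {ζ η : Config E} {h : V}
    (hflip : ∀ e, e ∈ within ends (cluster ends ζ h) → ζ e = true → η e = false) :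
    cluster ends ζ h ⊆ cluster ends (blue η) h := by
  -- the set of vertices of `C_R(h)(ζ)` that are blue-connected to `h` in `η` is closed under red
  -- adjacency inside the cluster
  have key : cluster ends ζ h ⊆ {x | x ∈ cluster ends ζ h ∧ x ∈ cluster ends (blue η) h} := by
    intro x hx
    refine mem_of_conn_of_closed (ends := ends) (ω := ζ) ?_
      ⟨mem_cluster_self _ _ _, mem_cluster_self _ _ _⟩ hx
    rintro y ⟨hy₁, hy₂⟩ z hyz
    have hz₁ : z ∈ cluster ends ζ h := mem_cluster_of_adj hy₁ hyz
    obtain ⟨_, e, he, hends⟩ := openGraph_adj.1 hyz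
    have hin : e ∈ within ends (cluster ends ζ h) := ⟨y, hy₁, z, hz₁, hends⟩
    have hηe : blue η e = true := by
      rw [blue_eq_true_iff]; exact hflip e hin he
    refine ⟨hz₁, mem_cluster_of_edge (ends := ends) hy₂ (e := e) hηe hends⟩
  intro x hx
  exact (key hx).2

/-- **2′SW-ALL gives (SW).** -/
theorem sw_of_swAll {l h o : V} (hs : SwAll ends l h o) : Sw ends l h o := by
  obtain ⟨f, hf, hmem⟩ := hs
  refine ⟨f, hf, fun x => ⟨(hmem x).1, ?_⟩⟩
  exact cluster_subset_of_red_flipped ends (hmem x).2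

/-- Row 2′SW-ALL over all finite graphs and markings. -/
def SwAll_all : Prop :=
  ∀ (V E : Type) [Fintype V] [DecidableEq V] [Fintype E] [DecidableEq E] (ends : E → Sym2 V)
    (l h o : V), l ≠ h → o ≠ l → o ≠ h → SwAll ends l h o

/-- `SwAll_all` gives `Sw_all`. -/
theorem sw_all_of_swAll_all (hs : SwAll_all) : Sw_all := by
  intro V E _ _ _ _ ends l h o hlh hol hoh
  exact sw_of_swAll ends (hs V E ends l h o hlh hol hoh)

end LocRows

end Summit.Ventures.PercRepro2
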